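import Literature.Algebra.Homology.TateCohomologyNormMap
import Literature.Algebra.Homology.CoinducedTateZeroShapiro
import HarnessLib

/-!
# Shapiro's lemma for Tate cohomology in degree `-1`: `(Coind_S^G B)_G ≅ B_S` compatibly with the
# norm maps, whence `Ĥ⁻¹(G, Coind_S^G B) ≅ Ĥ⁻¹(S, B)` (Brown VI (5.2), degree `-1`) — on Mathlib's
# `tateCohomology`

Topic `Algebra/Homology`; namespace `Literature.Algebra.Homology.CoindShapiro` (continuing the
tree's `CoinducedTateZeroShapiro`, which does degree `0`).  Imports the tree's
`TateCohomologyNormMap` (`Ĥ⁻¹ = ker N̄`, Brown VI §4) and `CoinducedTateZeroShapiro` (the functions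
`indicatorCoind b`, `(Coind_S^G B)^G ≅ B^S` by evaluation at `1`, `(N_G f)(1) = Σ_g f(g)`,
`Σ_g (indicatorCoind b)(g) = N_S b`); definitions with bodies and theorems; NO named fact, no
`sorry`.  Lane `lit-hodgefound` (Track 2 foundations library), seat p30 gen 16, row g16-#8 of
`run/shared/lean/pub/lit-hodgefound/SKELETON.md` (the degree excluded from row g16-#4
`TateCohomologyShapiro`).

Source followed.  K. S. Brown, *Cohomology of Groups*, GTM 87 (1982) [held copy
`book:brown1982-cohomology-groups`], VI §5 [chunk p0142]: "**(5.2)** If `H ⊆ G` and `M` is an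
`H`-module, then `Ĥ*(H, M) ≈ Ĥ*(G, ℤG ⊗_{ℤH} M)`"; VI §4 [p0141]: "`Ĥ⁻¹(G, M) = ker N̄ ⊆ H_0(G, M)`";
III §6 (6.2)/(5.9) (Shapiro, `ℤG ⊗_{ℤH} M ≅ Hom_{ℤH}(ℤG, M)` for `(G : H) < ∞`).  In degree `-1`,
(5.2) is the statement that the identification `H_0(G, Coind_H^G M) = (Coind_H^G M)_G ≅ M_H =
H_0(H, M)` (Shapiro in homological degree `0`) carries `ker N̄_G` onto `ker N̄_H`.  This file proves
it by hand on Mathlib's carrier `Rep.coind S.subtype B` (functions `f : G → B` with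
`f(s x) = s f(x)`, `(g f)(x) = f(x g)`):  `Θ : B_S → (Coind_S^G B)_G`, `[b] ↦ [indicatorCoind b]`
is an isomorphism (inverse `[f] ↦ Σ_{q ∈ G/S} [f(q̄⁻¹)]`; every `f` is `Σ_q q̄ · indicatorCoind
(f(q̄⁻¹))`), and under evaluation at `1` `N̄_G Θ[b] ↦ N̄_S [b]`.

## What is formalised (`k` a commutative ring, `G` a group, `S ≤ G`, `B : Rep k S`,
## `[DecidablePred (· ∈ S)]`; from §2 on `G` finite: `[Fintype G]`)

* §1 `indicatorLinear : B →ₗ Coind_S^G B` (`b ↦ indicatorCoind b`), `ρ_coe_indicatorCoind`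
  (`s · indicatorCoind b = indicatorCoind (s b)`), **`toCoinvariantsCoind : B_S →ₗ (Coind_S^G B)_G`**
  (`Θ`), `mul_out_mem_iff` (`x q̄ ∈ S ↔ x⁻¹ S = q`), **`eq_sum_ρ_indicatorCoind`**
  (`f = Σ_{q ∈ G/S} q̄ · indicatorCoind (f(q̄⁻¹))`), `toCoinvariantsCoind_surjective`.
* §2 `cosetSum f = Σ_q f(q̄⁻¹)`, its `G`-invariance modulo `I_S B` (`mk_cosetSum_ρ`),
  `coinvariantsSum : (Coind_S^G B)_G →ₗ B_S`, `coinvariantsSum_toCoinvariantsCoind` (left inverse),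
  **`coinvariantsCoindEquiv : (Coind_S^G B)_G ≃ₗ[k] B_S`** (Shapiro in homological degree `0`,
  Brown III (6.2) for `H₀`).
* §3 `coe_invariantsCoindEquiv_normBar_toCoinvariantsCoind` (`N̄_G Θ[b]` evaluates at `1` to
  `N_S b`), **`kerNormBarCoindEquiv : ker N̄_G ≃ₗ[k] ker N̄_S`**, and
  **`tateCohomologyCoindIsoNegOne S B : tateCohomology (Coind_S^G B) (-1) ≅ tateCohomology B (-1)`**.

## References
* K. S. Brown, *Cohomology of Groups*, GTM 87, Springer (1982), VI (5.2), VI §4; III (5.9), (6.2).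
  [Brown1982CohomologyGroups]
-/

noncomputable section

open CategoryTheory CategoryTheory.Limits

universe u

namespace Literature.Algebra.Homology

namespace CoindShapiro

variable {k G : Type u} [CommRing k] [Group G] (S : Subgroup G) (B : Rep.{u} k S)

/-- The right-translation action on `Coind_S^G B`: `(g · f)(x) = f(x g)` (plumbing). [folklore] -/
private theorem coind_ρ_apply' (g x : G) (f : Rep.coind S.subtype B) :
    (((Rep.coind S.subtype B).ρ g f : Rep.coind S.subtype B) : G → B) x = (f : G → B) (x * g) :=
  rfl

/-- The co-induction condition `f(s x) = s · f(x)` (plumbing). [folklore] -/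
private theorem coind_apply_mul' (f : Rep.coind S.subtype B) (s : S) (x : G) :
    (f : G → B) (s * x) = B.ρ s ((f : G → B) x) :=
  f.2 s x

/-! ## §0 Cosets: `x q̄ ∈ S ↔ x⁻¹S = q`; the coset sum `Σ_q f(q̄⁻¹)` and its `G`-invariance mod `I_S B` -/

/-- `x q̄ ∈ S ↔ x⁻¹ S = q` (`q̄ = q.out`): the unique coset whose representative pulls `x` into `S`
(plumbing). [folklore] -/
private theorem mul_out_mem_iff (x : G) (q : G ⧸ S) : x * q.out ∈ S ↔ ((x⁻¹ : G) : G ⧸ S) = q := by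
  constructor
  · intro h
    rw [← QuotientGroup.out_eq' q, QuotientGroup.eq, inv_inv]
    exact h
  · intro h
    have h' := h.trans (QuotientGroup.out_eq' q).symm
    rw [QuotientGroup.eq, inv_inv] at h'
    exact h'

/-- `f ↦ Σ_{q ∈ G/S} f(q̄⁻¹)`, `k`-linear in `f`. [cite: Brown1982CohomologyGroups, VI (5.2)] -/
def cosetSum [Fintype (G ⧸ S)] : Rep.coind S.subtype B →ₗ[k] B where
  toFun f := ∑ q : G ⧸ S, (f : G → B) q.out⁻¹
  map_add' f f' := by
    rw [← Finset.sum_add_distrib]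
    rfl
  map_smul' r f := by
    rw [RingHom.id_apply, Finset.smul_sum]
    rfl

/-- Unfolding lemma. [cite: Brown1982CohomologyGroups, VI (5.2)] -/
theorem cosetSum_apply [Fintype (G ⧸ S)] (f : Rep.coind S.subtype B) :
    cosetSum S B f = ∑ q : G ⧸ S, (f : G → B) q.out⁻¹ := rfl

/-- Changing the coset representative changes `f(q̄⁻¹)` by an element of `S`:
`[f((g⁻¹ q̄)⁻¹)] = [f(q̄'⁻¹)]` in `B_S`, where `q' = g⁻¹ q` (`g⁻¹ q̄ = q̄' s` with `s ∈ S`, and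
`f(s⁻¹ y) = s⁻¹ f(y)`). [cite: Brown1982CohomologyGroups, VI (5.2)] -/
theorem mk_apply_out_inv_mul (f : Rep.coind S.subtype B) (g : G) (q : G ⧸ S) :
    Representation.Coinvariants.mk B.ρ ((f : G → B) (q.out⁻¹ * g)) =
      Representation.Coinvariants.mk B.ρ ((f : G → B) ((g⁻¹ • q).out)⁻¹) := by
  have hmem : ((g⁻¹ • q).out)⁻¹ * (g⁻¹ * q.out) ∈ S := by
    rw [← QuotientGroup.eq, QuotientGroup.out_eq', ← smul_eq_mul, ← MulAction.Quotient.smul_coe,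
      QuotientGroup.out_eq']
  have hg : q.out⁻¹ * g = (((⟨_, hmem⟩ : S)⁻¹ : S) : G) * ((g⁻¹ • q).out)⁻¹ := by
    rw [Subgroup.coe_inv, Subgroup.coe_mk]
    group
  rw [hg, coind_apply_mul', Representation.Coinvariants.mk_self_apply]

/-- `Σ_q [f(q̄⁻¹ g)] = Σ_q [f(q̄⁻¹)]` in `B_S`: the coset sum is `G`-invariant modulo `I_S B`
(reindex the cosets by `q ↦ g⁻¹ q`). [cite: Brown1982CohomologyGroups, VI (5.2)] -/
theorem mk_cosetSum_ρ [Fintype (G ⧸ S)] (f : Rep.coind S.subtype B) (g : G) :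
    Representation.Coinvariants.mk B.ρ (cosetSum S B ((Rep.coind S.subtype B).ρ g f)) =
      Representation.Coinvariants.mk B.ρ (cosetSum S B f) := by
  rw [cosetSum_apply, cosetSum_apply, map_sum, map_sum]
  change ∑ q : G ⧸ S, Representation.Coinvariants.mk B.ρ ((f : G → B) (q.out⁻¹ * g)) = _
  exact Fintype.sum_equiv (MulAction.toPerm (g⁻¹) : Equiv.Perm (G ⧸ S))
    (fun q => Representation.Coinvariants.mk B.ρ ((f : G → B) (q.out⁻¹ * g)))
    (fun q => Representation.Coinvariants.mk B.ρ ((f : G → B) q.out⁻¹))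
    (fun q => mk_apply_out_inv_mul S B f g q)

/-- **`Φ : (Coind_S^G B)_G → B_S`, `[f] ↦ Σ_{q ∈ G/S} [f(q̄⁻¹)]`.** [cite: Brown1982CohomologyGroups, VI (5.2); III (6.2)] -/
def coinvariantsSum [Fintype (G ⧸ S)] :
    (Rep.coind S.subtype B).ρ.Coinvariants →ₗ[k] B.ρ.Coinvariants :=
  Representation.Coinvariants.lift (Rep.coind S.subtype B).ρ
    (Representation.Coinvariants.mk B.ρ ∘ₗ cosetSum S B) fun g =>
    LinearMap.ext fun f => mk_cosetSum_ρ S B f g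

variable [DecidablePred (· ∈ S)]

/-! ## §1 `Θ : B_S → (Coind_S^G B)_G`, `[b] ↦ [indicatorCoind b]`, and its surjectivity -/

/-- Values of `indicatorCoind b` on `S`: `x · b`. [cite: Brown1982CohomologyGroups, VI (5.2)] -/
theorem coe_indicatorCoind_of_mem (b : B) {x : G} (hx : x ∈ S) :
    (indicatorCoind S B b : G → B) x = B.ρ ⟨x, hx⟩ b :=
  dif_pos hx

/-- Values of `indicatorCoind b` off `S`: `0`. [cite: Brown1982CohomologyGroups, VI (5.2)] -/
theorem coe_indicatorCoind_of_not_mem (b : B) {x : G} (hx : x ∉ S) :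
    (indicatorCoind S B b : G → B) x = 0 :=
  dif_neg hx

/-- `b ↦ indicatorCoind b` is `k`-linear. [cite: Brown1982CohomologyGroups, VI (5.2)] -/
def indicatorLinear : B →ₗ[k] Rep.coind S.subtype B where
  toFun b := indicatorCoind S B b
  map_add' b b' := Subtype.ext <| funext fun x => by
    change (indicatorCoind S B (b + b') : G → B) x =
      (indicatorCoind S B b : G → B) x + (indicatorCoind S B b' : G → B) x
    by_cases hx : x ∈ S
    · rw [coe_indicatorCoind_of_mem S B _ hx, coe_indicatorCoind_of_mem S B _ hx,
        coe_indicatorCoind_of_mem S B _ hx, map_add]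
    · rw [coe_indicatorCoind_of_not_mem S B _ hx, coe_indicatorCoind_of_not_mem S B _ hx,
        coe_indicatorCoind_of_not_mem S B _ hx, add_zero]
  map_smul' r b := Subtype.ext <| funext fun x => by
    change (indicatorCoind S B (r • b) : G → B) x = r • (indicatorCoind S B b : G → B) x
    by_cases hx : x ∈ S
    · rw [coe_indicatorCoind_of_mem S B _ hx, coe_indicatorCoind_of_mem S B _ hx, map_smul]
    · rw [coe_indicatorCoind_of_not_mem S B _ hx, coe_indicatorCoind_of_not_mem S B _ hx, smul_zero]

/-- Unfolding lemma. [cite: Brown1982CohomologyGroups, VI (5.2)] -/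
@[simp]
theorem indicatorLinear_apply (b : B) : indicatorLinear S B b = indicatorCoind S B b := rfl

/-- `s · indicatorCoind b = indicatorCoind (s b)` for `s ∈ S`. [cite: Brown1982CohomologyGroups, VI (5.2)] -/
theorem ρ_coe_indicatorCoind (s : S) (b : B) :
    (Rep.coind S.subtype B).ρ (s : G) (indicatorCoind S B b) = indicatorCoind S B (B.ρ s b) := by
  refine Subtype.ext (funext fun x => ?_)
  rw [coind_ρ_apply']
  by_cases hx : x ∈ S
  · have hxs : x * s ∈ S := S.mul_mem hx s.2
    rw [coe_indicatorCoind_of_mem S B _ hxs, coe_indicatorCoind_of_mem S B _ hx,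
      ← Module.End.mul_apply, ← map_mul]
    rfl
  · have hxs : x * s ∉ S := fun h => hx (by simpa using S.mul_mem h (S.inv_mem s.2))
    rw [coe_indicatorCoind_of_not_mem S B _ hxs, coe_indicatorCoind_of_not_mem S B _ hx]

/-- **`Θ : B_S → (Coind_S^G B)_G`, `[b] ↦ [indicatorCoind b]`** (well defined since
`indicatorCoind (s b) = s · indicatorCoind b`). [cite: Brown1982CohomologyGroups, VI (5.2); III (6.2)] -/
def toCoinvariantsCoind :
    B.ρ.Coinvariants →ₗ[k] (Rep.coind S.subtype B).ρ.Coinvariants :=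
  Representation.Coinvariants.lift B.ρ
    (Representation.Coinvariants.mk (Rep.coind S.subtype B).ρ ∘ₗ indicatorLinear S B) fun s =>
    LinearMap.ext fun b => by
      change Representation.Coinvariants.mk _ (indicatorCoind S B (B.ρ s b)) =
        Representation.Coinvariants.mk _ (indicatorCoind S B b)
      rw [← ρ_coe_indicatorCoind, Representation.Coinvariants.mk_self_apply]

/-- `Θ [b] = [indicatorCoind b]`. [cite: Brown1982CohomologyGroups, VI (5.2)] -/
@[simp]
theorem toCoinvariantsCoind_mk (b : B) :
    toCoinvariantsCoind S B (Representation.Coinvariants.mk B.ρ b) =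
      Representation.Coinvariants.mk (Rep.coind S.subtype B).ρ (indicatorCoind S B b) :=
  rfl

/-- **Every `f ∈ Coind_S^G B` is `Σ_{q ∈ G/S} q̄ · indicatorCoind (f(q̄⁻¹))`** (`G/S` finite): on
`x` only the coset `q = x⁻¹ S` contributes, with value `(x q̄) f(q̄⁻¹) = f(x)`.
[cite: Brown1982CohomologyGroups, VI (5.2); III (5.9)] -/
theorem eq_sum_ρ_indicatorCoind [Fintype (G ⧸ S)] (f : Rep.coind S.subtype B) :
    f = ∑ q : G ⧸ S, (Rep.coind S.subtype B).ρ q.out (indicatorCoind S B ((f : G → B) q.out⁻¹)) := by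
  refine Subtype.ext (funext fun x => ?_)
  rw [Submodule.coe_sum, Finset.sum_apply,
    Finset.sum_eq_single ((x⁻¹ : G) : G ⧸ S)]
  · have hx : x * ((x⁻¹ : G) : G ⧸ S).out ∈ S := (mul_out_mem_iff S x _).2 rfl
    rw [coind_ρ_apply', coe_indicatorCoind_of_mem S B _ hx, ← coind_apply_mul']
    change (f : G → B) x = (f : G → B) (x * ((x⁻¹ : G) : G ⧸ S).out * (((x⁻¹ : G) : G ⧸ S).out)⁻¹)
    rw [mul_inv_cancel_right]
  · intro q _ hq
    rw [coind_ρ_apply', coe_indicatorCoind_of_not_mem S B _ (fun h => hq ((mul_out_mem_iff S x q).1 h).symm)]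
  · intro h
    exact absurd (Finset.mem_univ _) h

/-- **`Θ` is onto**: `[f] = Θ [Σ_q f(q̄⁻¹)]`. [cite: Brown1982CohomologyGroups, VI (5.2); III (6.2)] -/
theorem toCoinvariantsCoind_mk_sum [Fintype (G ⧸ S)] (f : Rep.coind S.subtype B) :
    toCoinvariantsCoind S B (Representation.Coinvariants.mk B.ρ (∑ q : G ⧸ S, (f : G → B) q.out⁻¹)) =
      Representation.Coinvariants.mk (Rep.coind S.subtype B).ρ f := by
  conv_rhs => rw [eq_sum_ρ_indicatorCoind S B f]
  rw [map_sum, map_sum, map_sum]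
  refine Finset.sum_congr rfl fun q _ => ?_
  rw [toCoinvariantsCoind_mk, Representation.Coinvariants.mk_self_apply]

/-- `Θ` is surjective. [cite: Brown1982CohomologyGroups, VI (5.2); III (6.2)] -/
theorem toCoinvariantsCoind_surjective [Fintype (G ⧸ S)] :
    Function.Surjective (toCoinvariantsCoind S B) := by
  intro c
  obtain ⟨f, rfl⟩ := Representation.Coinvariants.mk_surjective _ c
  exact ⟨_, toCoinvariantsCoind_mk_sum S B f⟩

/-! ## §2 The inverse `[f] ↦ Σ_{q ∈ G/S} [f(q̄⁻¹)]` and `(Coind_S^G B)_G ≅ B_S` -/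

/-- `Φ (Θ [b]) = [b]`: in `Σ_q indicatorCoind b (q̄⁻¹)` only the coset `S` contributes, with
`q̄⁻¹ · b ≡ b`. [cite: Brown1982CohomologyGroups, VI (5.2); III (6.2)] -/
theorem coinvariantsSum_toCoinvariantsCoind [Fintype (G ⧸ S)] (c : B.ρ.Coinvariants) :
    coinvariantsSum S B (toCoinvariantsCoind S B c) = c := by
  induction c using Representation.Coinvariants.induction_on with
  | h b =>
    rw [toCoinvariantsCoind_mk]
    change Representation.Coinvariants.mk B.ρ (cosetSum S B (indicatorCoind S B b)) = _
    rw [cosetSum_apply, Finset.sum_eq_single ((1 : G) : G ⧸ S)]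
    · have hout : (((1 : G) : G ⧸ S).out) ∈ S := by
        have h := QuotientGroup.eq.1 (QuotientGroup.out_eq' ((1 : G) : G ⧸ S)).symm
        rwa [inv_one, one_mul] at h
      rw [coe_indicatorCoind_of_mem S B b (S.inv_mem hout)]
      exact Representation.Coinvariants.mk_self_apply B.ρ ⟨_, S.inv_mem hout⟩ b
    · intro q _ hq
      rw [coe_indicatorCoind_of_not_mem]
      intro hmem
      apply hq
      rw [← QuotientGroup.out_eq' q, QuotientGroup.eq, mul_one]
      exact hmem
    · intro h
      exact absurd (Finset.mem_univ _) h

/-- `Θ` is injective (it has the left inverse `Φ`). [cite: Brown1982CohomologyGroups, VI (5.2); III (6.2)] -/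
theorem toCoinvariantsCoind_injective [Fintype (G ⧸ S)] :
    Function.Injective (toCoinvariantsCoind S B) :=
  Function.LeftInverse.injective (coinvariantsSum_toCoinvariantsCoind S B)

/-- **`B_S ≅ (Coind_S^G B)_G`** (`Θ` as a linear equivalence). [cite: Brown1982CohomologyGroups, VI (5.2); III (6.2)] -/
def toCoinvariantsCoindEquiv [Fintype (G ⧸ S)] :
    B.ρ.Coinvariants ≃ₗ[k] (Rep.coind S.subtype B).ρ.Coinvariants :=
  LinearEquiv.ofBijective (toCoinvariantsCoind S B)
    ⟨toCoinvariantsCoind_injective S B, toCoinvariantsCoind_surjective S B⟩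

/-- **Shapiro in homological degree `0`: `(Coind_S^G B)_G ≅ B_S`** (`H₀(G, Coind_S^G B) ≅ H₀(S, B)`,
Brown III (6.2) with (5.9)). [cite: Brown1982CohomologyGroups, III (6.2), (5.9); VI (5.2)] -/
def coinvariantsCoindEquiv [Fintype (G ⧸ S)] :
    (Rep.coind S.subtype B).ρ.Coinvariants ≃ₗ[k] B.ρ.Coinvariants :=
  (toCoinvariantsCoindEquiv S B).symm

/-! ## §3 The norms: `N̄_G Θ = N̄_S` under evaluation at `1`; `ker N̄_G ≅ ker N̄_S`; `Ĥ⁻¹` -/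

section Norm

variable [Fintype G]

omit [DecidablePred (· ∈ S)] [Fintype G] in
/-- Evaluation at `1` of the tree's `invariantsCoindEquiv` (restated; definitional). [cite: Brown1982CohomologyGroups, VI (5.2)] -/
theorem coe_invariantsCoindEquiv_apply' (y : (Rep.coind S.subtype B).ρ.invariants) :
    ((invariantsCoindEquiv S B y : B.ρ.invariants) : B) =
      ((y : Rep.coind S.subtype B) : G → B) 1 :=
  rfl

/-- **`N̄_G (Θ [b])` is the constant function `N_S b`**: under evaluation at `1`,
`invariantsCoindEquiv (N̄_G (Θ c)) = N̄_S c` (`(N_G indicatorCoind b)(1) = Σ_g indicatorCoind b (g) =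
N_S b`). [cite: Brown1982CohomologyGroups, VI (5.2)] -/
theorem invariantsCoindEquiv_normBar_toCoinvariantsCoind (c : B.ρ.Coinvariants) :
    invariantsCoindEquiv S B (normBar (Rep.coind S.subtype B).ρ (toCoinvariantsCoind S B c)) =
      normBar B.ρ c := by
  induction c using Representation.Coinvariants.induction_on with
  | h b =>
    apply Subtype.ext
    rw [coe_invariantsCoindEquiv_apply', toCoinvariantsCoind_mk, normBar_mk, normBar_mk,
      coind_norm_apply_one, sum_indicatorCoind]

/-- `Θ` carries `ker N̄_S` onto `ker N̄_G`. [cite: Brown1982CohomologyGroups, VI (5.2)] -/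
theorem map_toCoinvariantsCoindEquiv_ker_normBar [Fintype (G ⧸ S)] :
    (LinearMap.ker (normBar B.ρ)).map
        ((toCoinvariantsCoindEquiv S B : B.ρ.Coinvariants ≃ₗ[k] _) : B.ρ.Coinvariants →ₗ[k] _) =
      LinearMap.ker (normBar (Rep.coind S.subtype B).ρ) := by
  apply le_antisymm
  · rintro _ ⟨c, hc, rfl⟩
    change toCoinvariantsCoind S B c ∈ LinearMap.ker (normBar (Rep.coind S.subtype B).ρ)
    rw [LinearMap.mem_ker]
    apply (invariantsCoindEquiv S B).injective
    rw [invariantsCoindEquiv_normBar_toCoinvariantsCoind, map_zero]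
    exact hc
  · intro d hd
    obtain ⟨c, rfl⟩ := toCoinvariantsCoind_surjective S B d
    refine ⟨c, ?_, rfl⟩
    change c ∈ LinearMap.ker (normBar B.ρ)
    rw [LinearMap.mem_ker, ← invariantsCoindEquiv_normBar_toCoinvariantsCoind,
      LinearMap.mem_ker.1 hd, map_zero]

/-- **`ker N̄_G (Coind_S^G B) ≅ ker N̄_S (B)`** — the carriers of `Ĥ⁻¹(G, Coind_S^G B)` and
`Ĥ⁻¹(S, B)`. [cite: Brown1982CohomologyGroups, VI (5.2), VI §4] -/
def kerNormBarCoindEquiv [Fintype (G ⧸ S)] :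
    LinearMap.ker (normBar (Rep.coind S.subtype B).ρ) ≃ₗ[k] LinearMap.ker (normBar B.ρ) :=
  (LinearEquiv.ofSubmodules (toCoinvariantsCoindEquiv S B) _ _
    (map_toCoinvariantsCoindEquiv_ker_normBar S B)).symm

/-- **Brown VI (5.2) in degree `-1`: `Ĥ⁻¹(G, Coind_S^G B) ≅ Ĥ⁻¹(S, B)`** on Mathlib's
`tateCohomology` (`Ĥ⁻¹ = ker N̄` on both sides, the tree's `tateCohomologyNegOneIso`).
[cite: Brown1982CohomologyGroups, VI (5.2), VI §4] -/
def tateCohomologyCoindIsoNegOne :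
    tateCohomology (Rep.coind S.subtype B) (-1) ≅ tateCohomology B (-1) :=
  tateCohomologyNegOneIso (Rep.coind S.subtype B) ≪≫ (kerNormBarCoindEquiv S B).toModuleIso ≪≫
    (tateCohomologyNegOneIso B).symm

/-- `Ĥ⁻¹(G, Coind_S^G B) = 0 ↔ Ĥ⁻¹(S, B) = 0`. [cite: Brown1982CohomologyGroups, VI (5.2)] -/
theorem isZero_tateCohomology_coind_negOne_iff :
    IsZero (tateCohomology (Rep.coind S.subtype B) (-1)) ↔ IsZero (tateCohomology B (-1)) :=
  ⟨fun h => h.of_iso (tateCohomologyCoindIsoNegOne S B).symm,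
    fun h => h.of_iso (tateCohomologyCoindIsoNegOne S B)⟩

end Norm

end CoindShapiro

end Literature.Algebra.Homology
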